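import Summits.QuantumFields.YangMills.Theorems.FluctuationComparisonRegPrIntLLargeFieldGasBareKnit
import Summits.QuantumFields.YangMills.Theorems.FluctuationComparisonRegPrIntLLargeFieldGasFourPtOfAEIdentity
import Summits.QuantumFields.YangMills.Theorems.FluctuationComparisonRegPrIntLLargeFieldGasOfEnginePackage
import HarnessLib

/-!
# THE REGISTERED LF STUB FROM THE BARE ENGINE PACKAGE (G19, px10 lineage, FILE L): ✓FILE 10's prefix threading WITHOUT the continuity row, ending in ✓FILE J —
# ★★★ `aeIntBare_of_enginePackageBare` and ★★★ `largeFieldFourPtIntCan_of_enginePackageBare`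

Cell `ym3-torus` (HUMAN RULING D-0037: rung R3 = continuum `SU(2)` Yang–Mills on `T³` — NOT `d = 4`, NOT infinite volume, NOT a mass gap, NOT the Clay problem); width seat
`ym3-torus-px10` (gen 19); helper of the crux `stmt-QuantumFields-20520` `UnitScaleTilt.FluctuationComparisonRegPrIntL` (`--supports … --as helper`, NOT a proof of it).
THEOREMS ONLY: 0 `def`, 0 `instance`, 0 `notation`, 0 `sorry`, default heartbeats.

WHAT.  ✓FILE 10 `…LargeFieldGasOfEnginePackage.largeFieldFourPtIntCan_of_enginePackage` made the registered `stub_largeFieldFourPtIntCan` rest on ONE package of ENGINE ROWS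
`hE`, among them `∀ Q′ X, Adm Q′ X → ContinuousOn (ζ Q′ X ·) W_J^{c}`.  ✓FILE J showed that row is not needed for the registered (pointwise) four-point statement; ✓FILE K
struck it from the knit and the socket.  THIS FILE strikes it from the package: §1 ★★★`aeIntBare_of_enginePackageBare : ⟨hE minus the continuity row⟩ → ⟨LFG^{ae,bare}∘⟩`
(✓FILE J's hypothesis VERBATIM) — ✓FILE 10's proof verbatim (`pS ↦ max pS 1`, `γ₁ := min γE γ_budget` by ✓`exists_located_budget_blocks_small`, `κ := (6L^μ)⁻¹`, the rate row
from `4 + 2 log 26 ≤ κμ`) ending in ✓FILE K `aeIntBareBody_of_engineBare`; §2 ★★★`largeFieldFourPtIntCan_of_enginePackageBare : ⟨hE minus the continuity row⟩ →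
⟨LargeFieldFourPtIntCan :588 VERBATIM⟩ := largeFieldFourPtIntCan_of_aeIntBare ∘ §1`.  So the BARE ENGINE PACKAGE — footprint map, a.e. ratio identities per deep history,
V-locality, window majorant, energy bound, the pure number — is what the 𝐑-operation hand owes at this stub; its activities need be neither continuous nor measurable.

HONEST — WHAT THIS IS NOT.  Re-threading; nothing of Bałaban's analysis; the bare engine package IS the 𝐑-operation's output (XL, OPEN); `h2P`∕`h2W`, LF-INT∘,
`stub_largeFieldFourPtIntCan`, S2β, the crux 20520 NOT proved; `YM3TorusSU2` NOT proved; finite volume ∕ conditional; the Yang–Mills mass gap (Clay) NOT proved; rung R3 =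
YM₃ on `T³` — NOT `d = 4`, NOT infinite volume, NOT a mass gap.
References: [Balaban1985UV3] CMP 102 (1985) Thm 1 p.257, Thm 2 p.272, (41), (43)–(47) pp.266–267, (67)–(71) pp.273–274; [Balaban1989LargeFieldII] CMP 122 (1989) (1.84) p.386,
(1.90)–(1.91) p.388, (1.97)–(1.101) pp.389–390; [Balaban1988Convergent] CMP 119 (1988) §2 (2.18)–(2.27); [KoteckyPreiss1986] CMP 103 (1986) Theorem p.492 (1).
-/

set_option autoImplicit false

noncomputable section

open Finset MeasureTheory Filter Topology Set
open scoped BigOperators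
open Literature.Probability.LatticeModels
open Literature.MathematicalPhysics.QuantumFieldTheory.Balaban1983to89
open Literature.MathematicalPhysics.QuantumFieldTheory.Balaban1983to89.T3ContinuumYM3Torus
open Literature.MathematicalPhysics.QuantumFieldTheory.Balaban1983to89.T3NestedUnitLaws
open Literature.MathematicalPhysics.QuantumFieldTheory.Balaban1983to89.T3UnitLawDensityEML
open Literature.MathematicalPhysics.QuantumFieldTheory.Balaban1983to89.T3UnitScaleTilt
open Literature.MathematicalPhysics.QuantumFieldTheory.Balaban1983to89.T3TiltDescent
open Literature.MathematicalPhysics.QuantumFieldTheory.Balaban1983to89.T3PrintedRegularMinimiser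
open Literature.MathematicalPhysics.QuantumFieldTheory.Balaban1983to89.T3LevelShift
open Literature.MathematicalPhysics.QuantumFieldTheory.Balaban1983to89.Missing
open Literature.MathematicalPhysics.QuantumFieldTheory.Balaban1983to89.T4Continuum
open scoped Literature.MathematicalPhysics.QuantumFieldTheory.Balaban1983to89.T3OrbitAverage
open Literature.MathematicalPhysics.QuantumFieldTheory.Balaban1983to89.Node00 (touchingGraph SiteTouch)
open Literature.MathematicalPhysics.QuantumFieldTheory.Balaban1983to89.B5Eq118OneStroke (iterBlockOf iterBlock)
open Literature.MathematicalPhysics.QuantumFieldTheory.BalabanImbrieJaffe1984to88.BIJ85BlockAveragesTorusK (blkIter)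
open Summit.QuantumFields.YangMills.Theorems.FluctuationComparisonRegPrIntLWregGlue (heightDensityCan)
open Summit.QuantumFields.YangMills.Theorems.FluctuationComparisonRegPrIntLHistoryPartition (LFLabel histEvent smallFactor smallFactor_pos)
open Summit.QuantumFields.YangMills.Theorems.FluctuationComparisonRegPrIntLLargeFieldGasOfEnginePackage (exists_located_budget_blocks_small)
open Summit.QuantumFields.YangMills.Theorems.FluctuationComparisonRegPrIntLLargeFieldGasBareKnit (aeIntBareBody_of_engineBare)
open Summit.QuantumFields.YangMills.Theorems.FluctuationComparisonRegPrIntLLargeFieldGasFourPtOfAEIdentity (largeFieldFourPtIntCan_of_aeIntBare)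

namespace Summit.QuantumFields.YangMills.Theorems.FluctuationComparisonRegPrIntLLargeFieldGasBareOfEnginePackage

/-! ## §1 ⟨LFG^{ae,bare}∘⟩ from the bare engine package -/

open Classical in
/-- ★★★ **⟨LFG^{ae,bare}∘⟩ FROM THE BARE ENGINE PACKAGE** — ✓FILE 10 `canInt_of_enginePackage` with the continuity row struck from the package and the conclusion the BARE a.e.
identity (✓FILE J's hypothesis, VERBATIM): same prefix threading (`pS ↦ max pS 1`, `γ₁ := min γE γ_budget`, `κ := (6L^μ)⁻¹`, `Ψ :=` the located block budget of ✓FILE 10 §1),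
per `(J,K)` ✓FILE K `aeIntBareBody_of_engineBare`. [cite: Balaban1985UV3, (43)-(47) pp.266-267 and (67)-(71) pp.273-274; Balaban1989LargeFieldII, (1.84) p.386, (1.90)-(1.91) p.388 and (1.97)-(1.101) pp.389-390; KoteckyPreiss1986, Theorem p.492 (1)] -/
theorem aeIntBare_of_enginePackageBare
    (hE : ∀ (L : ℕ), ∃ μ : ℕ, ∃ a : ℝ, 0 < a ∧ ∃ c₀ : ℝ, 0 < c₀ ∧ c₀ ≤ 1 ∧ ∀ (c : ℝ), 0 < c → c ≤ c₀ → ∃ pS : ℝ, ∀ (b₀ p₀ : ℝ), 0 < b₀ → pS ≤ p₀ → 0 < p₀ →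
      ∃ γE : ℝ, 0 < γE ∧ ∀ (F : T3Family) (γ : ℝ), F.L = L → 0 < γ → γ ≤ γE →
        ∀ (J K : ℕ) (hJK : J ≤ K),
          {U : GaugeField (F.P J) 0 (Matrix.specialUnitaryGroup (Fin 2) ℂ) | PlaqSmall (θBal F.L γ (c * b₀) p₀ J) U} ⊆
            Node00.regSet (fieldMeasure (F.P J) 0 (Matrix.specialUnitaryGroup (Fin 2) ℂ)) (heightDensity F γ hJK Set.univ) →
          (∀ U : GaugeField (F.P J) 0 (Matrix.specialUnitaryGroup (Fin 2) ℂ), PlaqSmall (θBal F.L γ (c * b₀) p₀ J) U →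
              0 < heightDensityCan F γ hJK Set.univ U) →
          (∀ U : GaugeField (F.P J) 0 (Matrix.specialUnitaryGroup (Fin 2) ℂ), PlaqSmall (θBal F.L γ (c * b₀) p₀ J) U →
              0 < heightDensityCan F γ hJK (histGood F ℰp (θBal F.L γ b₀ p₀) K J) U) →
          -- ═══ the engine's output at `(J, K)`: a grain and Bałaban's expansion with holes ═══
          ∃ μ' : ℕ, μ' ≤ μ ∧ μ' ≤ F.m + J ∧
          ∃ (Adm : Finset (LFLabel F K J) → Finset (PBond (F.P J) 0) → Prop)
            (ζ : Finset (LFLabel F K J) → Finset (PBond (F.P J) 0) → GaugeField (F.P J) 0 (Matrix.specialUnitaryGroup (Fin 2) ℂ) → ℝ)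
            (ζbar : Finset (LFLabel F K J) → Finset (PBond (F.P J) 0) → ℝ) (κmu : ℝ),
            -- footprint map
            (∀ Q' X, Adm Q' X → Q'.Nonempty ∧
              (∀ l ∈ Q', l.1.val < K - J ∧
              (⟨siteShift (F.sitesPerDir_eq (m := F.m) (K := K) (j := l.1.val + (K - J - l.1.val)) (m' := F.m) (K' := J) (j' := 0)
              (by have := l.1.isLt; omega)) (blkIter (K - J - l.1.val) l.2.src), l.2.μ⟩ : PBond (F.P J) 0) ∈ X) ∧
              ∃ Fc : Finset (Site (F.P J) μ'), ((touchingGraph (SiteTouch (P := F.P J) (j := μ'))).induce (Fc : Set (Site (F.P J) μ'))).Connected ∧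
              Fc.biUnion (fun y => Finset.univ.filter (fun b : PBond (F.P J) 0 => iterBlockOf μ' b.src = y)) = X) ∧
            -- the a.e. ratio identity of the expansion with holes, per deep history, on the window
            (∀ Q : Finset (LFLabel F K J), (∀ l ∈ Q, l.1.val < K - J) →
              ∀ᵐ U ∂fieldMeasure (F.P J) 0 (Matrix.specialUnitaryGroup (Fin 2) ℂ), PlaqSmall (θBal F.L γ (c * b₀) p₀ J) U →
              heightDensity F γ hJK (histEvent F (θBal F.L γ b₀ p₀) K J Q) U =
              heightDensity F γ hJK (histGood F ℰp (θBal F.L γ b₀ p₀) K J) U *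
              ∑ 𝒳 ∈ (Finset.univ : Finset (Finset (PBond (F.P J) 0))).powerset.filter (fun 𝒳 => IsCompatible polyInc 𝒳 ∧
              (∀ l ∈ Q, ∃ X ∈ 𝒳, (⟨siteShift (F.sitesPerDir_eq (m := F.m) (K := K) (j := l.1.val + (K - J - l.1.val)) (m' := F.m) (K' := J)
              (j' := 0) (by have := l.1.isLt; omega)) (blkIter (K - J - l.1.val) l.2.src), l.2.μ⟩ : PBond (F.P J) 0) ∈ X) ∧
              ∀ X ∈ 𝒳, Adm (Q.filter fun l => (⟨siteShift (F.sitesPerDir_eq (m := F.m) (K := K) (j := l.1.val + (K - J - l.1.val))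
              (m' := F.m) (K' := J) (j' := 0) (by have := l.1.isLt; omega)) (blkIter (K - J - l.1.val) l.2.src), l.2.μ⟩ : PBond (F.P J) 0) ∈ X) X),
              ∏ X ∈ 𝒳, ζ (Q.filter fun l => (⟨siteShift (F.sitesPerDir_eq (m := F.m) (K := K) (j := l.1.val + (K - J - l.1.val))
              (m' := F.m) (K' := J) (j' := 0) (by have := l.1.isLt; omega)) (blkIter (K - J - l.1.val) l.2.src), l.2.μ⟩ : PBond (F.P J) 0) ∈ X) X U) ∧
            -- continuous, V-local activities with a window-uniform majorant
            (∀ Q' X (U U' : GaugeField (F.P J) 0 (Matrix.specialUnitaryGroup (Fin 2) ℂ)), Adm Q' X → (∀ e ∈ X, U e = U' e) → ζ Q' X U = ζ Q' X U') ∧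
            (∀ Q' X U, Adm Q' X → PlaqSmall (θBal F.L γ (c * b₀) p₀ J) U → |ζ Q' X U| ≤ ζbar Q' X) ∧
            (∀ Q' X, Adm Q' X → 0 ≤ ζbar Q' X) ∧
            -- the energy bound: one small factor per hole, tree decay per block
            (∀ Q' X, Adm Q' X → ζbar Q' X ≤
              (∏ l ∈ Q', (if l.1.val < K - J then smallFactor F.L γ b₀ p₀ a (K - l.1.val) else 0)) *
              Real.exp (-(κmu * ((X.image (fun b : PBond (F.P J) 0 => iterBlockOf μ' b.src)).card : ℝ)))) ∧
            -- tree decay per block beats the entropy of block animals (a pure number)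
            4 + 2 * Real.log 26 ≤ κmu) :
    ∀ (L : ℕ), ∃ c₀ : ℝ, 0 < c₀ ∧ c₀ ≤ 1 ∧ ∀ (c : ℝ), 0 < c → c ≤ c₀ → ∃ pS : ℝ, ∀ (b₀ p₀ : ℝ), 0 < b₀ → pS ≤ p₀ → 0 < p₀ →
      ∃ γ₁ : ℝ, 0 < γ₁ ∧ ∃ κ : ℝ, 0 < κ ∧ ∀ (F : T3Family) (γ : ℝ), F.L = L → 0 < γ → γ ≤ γ₁ →
        ∃ Ψ : ℕ → ℝ, (∀ J, 0 ≤ Ψ J) ∧ Tendsto (fun J : ℕ => (J : ℝ) * Ψ J) atTop (𝓝 0) ∧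
          ∀ (J K : ℕ) (hJK : J ≤ K),
            {U : GaugeField (F.P J) 0 (Matrix.specialUnitaryGroup (Fin 2) ℂ) | PlaqSmall (θBal F.L γ (c * b₀) p₀ J) U} ⊆
              Node00.regSet (fieldMeasure (F.P J) 0 (Matrix.specialUnitaryGroup (Fin 2) ℂ)) (heightDensity F γ hJK Set.univ) →
            (∀ U : GaugeField (F.P J) 0 (Matrix.specialUnitaryGroup (Fin 2) ℂ), PlaqSmall (θBal F.L γ (c * b₀) p₀ J) U →
                0 < heightDensityCan F γ hJK Set.univ U) →
            (∀ U : GaugeField (F.P J) 0 (Matrix.specialUnitaryGroup (Fin 2) ℂ), PlaqSmall (θBal F.L γ (c * b₀) p₀ J) U →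
                0 < heightDensityCan F γ hJK (histGood F ℰp (θBal F.L γ b₀ p₀) K J) U) →
            ∃ (cst : ℝ) (w : GaugeField (F.P J) 0 (Matrix.specialUnitaryGroup (Fin 2) ℂ) → Finset (PBond (F.P J) 0) → ℝ),
              (∃ (wbar a ℓ : Finset (PBond (F.P J) 0) → ℝ),
                (∀ U, w U ∅ = 0) ∧
                (∀ (X : Finset (PBond (F.P J) 0)) (U U' : GaugeField (F.P J) 0 (Matrix.specialUnitaryGroup (Fin 2) ℂ)),
                  (∀ e ∈ X, U e = U' e) → w U X = w U' X) ∧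
                (∀ X, 0 ≤ a X) ∧ (∀ X, 0 ≤ ℓ X) ∧
                (∀ U, U ∈ {U : GaugeField (F.P J) 0 (Matrix.specialUnitaryGroup (Fin 2) ℂ) | PlaqSmall (θBal F.L γ (c * b₀) p₀ J) U} →
                  ∀ X, |w U X| ≤ wbar X) ∧
                (∀ X : Finset (PBond (F.P J) 0), ∀ e ∈ X, ∀ e' ∈ X, (e.src.tdist e'.src : ℝ) ≤ ℓ X) ∧
                (∀ X : Finset (PBond (F.P J) 0), ∑ X' ∈ Finset.univ.filter (fun X' => polyInc X' X),
                    wbar X' * Real.exp (a X' + κ * ℓ X') ≤ a X) ∧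
                (∀ e : PBond (F.P J) 0, a {e} ≤ Ψ J)) ∧
              ∀ᵐ U ∂fieldMeasure (F.P J) 0 (Matrix.specialUnitaryGroup (Fin 2) ℂ), PlaqSmall (θBal F.L γ (c * b₀) p₀ J) U →
                heightDensity F γ hJK Set.univ U = Real.exp cst * heightDensity F γ hJK (histGood F ℰp (θBal F.L γ b₀ p₀) K J) U *
                  (polymerPartitionFunction polyInc (fun X : Finset (PBond (F.P J) 0) => ((w U X : ℝ) : ℂ)) Finset.univ).re := by
  intro L
  obtain ⟨μ, a, ha, c₀, hc₀, hc₀1, HE⟩ := hE L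
  refine ⟨c₀, hc₀, hc₀1, fun c hc hcc₀ => ?_⟩
  obtain ⟨pS, HE⟩ := HE c hc hcc₀
  refine ⟨max pS 1, fun b₀ p₀ hb hpS hp => ?_⟩
  have hp1 : 1 ≤ p₀ := (le_max_right pS 1).trans hpS
  obtain ⟨γE, hγE, HE⟩ := HE b₀ p₀ hb ((le_max_left pS 1).trans hpS) hp
  by_cases hL : 1 < L
  · -- the honest case: block size `L > 1`
    have hL1 : (1 : ℝ) ≤ L := by exact_mod_cast hL.le
    have hLμ : (0 : ℝ) < 6 * (L : ℝ) ^ μ := by positivity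
    have hS : (0 : ℝ) < 3 * ((L : ℝ) ^ 3) ^ μ + 1 := by positivity
    obtain ⟨γB, hγB, hγB1, HB⟩ := exists_located_budget_blocks_small hL hb hp1 ha μ (ε := (3 * ((L : ℝ) ^ 3) ^ μ + 1)⁻¹) (inv_pos.mpr hS)
    refine ⟨min γE γB, lt_min hγE hγB, (6 * (L : ℝ) ^ μ)⁻¹, inv_pos.mpr hLμ, fun F γ hFL hγ hγle => ?_⟩
    obtain ⟨Ψ, hΨ0, hΨε, hΨt, HΨ⟩ := HB γ hγ (hγle.trans (min_le_right _ _))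
    refine ⟨Ψ, hΨ0, hΨt, fun J K hJK hR hP₁ hP₂ => ?_⟩
    obtain ⟨μ', hμ'μ, hμ'J, Adm, ζ, ζbar, κmu, hAdm, hrat, hloc, hdom, hζ0, hζ, hrate⟩ :=
      HE F γ hFL hγ (hγle.trans (min_le_left _ _)) J K hJK hR hP₁ hP₂
    have hγ1 : γ ≤ 1 := hγle.trans ((min_le_right _ _).trans hγB1)
    -- the rate row of FILE 9 from the pure number `4 + 2 log 26 ≤ κμ`
    have hrow : Ψ J * (3 * ((F.L : ℝ) ^ 3) ^ μ') + (6 * (L : ℝ) ^ μ)⁻¹ * (6 * (F.L : ℝ) ^ μ') + 2 * Real.log 26 + Ψ J + 2 ≤ κmu := by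
      rw [hFL]
      have hA : ((L : ℝ) ^ 3) ^ μ' ≤ ((L : ℝ) ^ 3) ^ μ := pow_le_pow_right₀ (one_le_pow₀ hL1) hμ'μ
      have hB : (6 * (L : ℝ) ^ μ)⁻¹ * (6 * (L : ℝ) ^ μ') ≤ 1 := by
        have h6 : 6 * (L : ℝ) ^ μ' ≤ 6 * (L : ℝ) ^ μ := by
          have := pow_le_pow_right₀ hL1 hμ'μ
          linarith
        calc (6 * (L : ℝ) ^ μ)⁻¹ * (6 * (L : ℝ) ^ μ') ≤ (6 * (L : ℝ) ^ μ)⁻¹ * (6 * (L : ℝ) ^ μ) :=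
              mul_le_mul_of_nonneg_left h6 (inv_pos.mpr hLμ).le
          _ = 1 := inv_mul_cancel₀ hLμ.ne'
      have hC : Ψ J * (3 * ((L : ℝ) ^ 3) ^ μ') + Ψ J ≤ 1 := by
        have h1 : Ψ J * (3 * ((L : ℝ) ^ 3) ^ μ') + Ψ J ≤ Ψ J * (3 * ((L : ℝ) ^ 3) ^ μ + 1) := by
          have := mul_le_mul_of_nonneg_left hA (hΨ0 J)
          nlinarith
        have h2 : Ψ J * (3 * ((L : ℝ) ^ 3) ^ μ + 1) ≤ (3 * ((L : ℝ) ^ 3) ^ μ + 1)⁻¹ * (3 * ((L : ℝ) ^ 3) ^ μ + 1) :=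
          mul_le_mul_of_nonneg_right (hΨε J) hS.le
        rw [inv_mul_cancel₀ hS.ne'] at h2
        linarith
      linarith
    exact aeIntBareBody_of_engineBare F hγ hγ1 hb p₀ (hcc₀.trans hc₀1) hJK (inv_pos.mpr hLμ).le Ψ (hΨ0 J) a μ' hμ'J
      (HΨ F hFL J K hJK μ' hμ'μ hμ'J) Adm hAdm ζ ζbar κmu hrat hloc hdom hζ0 hζ hrow
  · -- no `T3Family` has block size `≤ 1`: the family clause is vacuous
    exact ⟨1, one_pos, 1, one_pos, fun F γ hFL _ _ => absurd (hFL ▸ F.hL.2) hL⟩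


/-! ## §2 The registered stub from the bare engine package -/

open Classical in
/-- ★★★ **THE REGISTERED `LargeFieldFourPtIntCan` (registry v11.4 :588, VERBATIM) FROM THE BARE ENGINE PACKAGE** = ✓FILE 10's `hE` with its ONE continuity row
`(∀ Q′ X, Adm Q′ X → ContinuousOn (ζ Q′ X ·) W_J^{c}) ∧` DELETED: `largeFieldFourPtIntCan_of_aeIntBare ∘ aeIntBare_of_enginePackageBare`.  So the engine's rows are: footprint
map, a.e. ratio identities, V-locality, majorant, energy, numeric — NO continuity, NO measurability. [cite: Balaban1985UV3, Thm 1 p.257, Thm 2 p.272, (41), (43)-(47) pp.266-267; Balaban1989LargeFieldII, (1.90) p.388 and (1.97)-(1.101) pp.389-390] -/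
theorem largeFieldFourPtIntCan_of_enginePackageBare
    (hE : ∀ (L : ℕ), ∃ μ : ℕ, ∃ a : ℝ, 0 < a ∧ ∃ c₀ : ℝ, 0 < c₀ ∧ c₀ ≤ 1 ∧ ∀ (c : ℝ), 0 < c → c ≤ c₀ → ∃ pS : ℝ, ∀ (b₀ p₀ : ℝ), 0 < b₀ → pS ≤ p₀ → 0 < p₀ →
      ∃ γE : ℝ, 0 < γE ∧ ∀ (F : T3Family) (γ : ℝ), F.L = L → 0 < γ → γ ≤ γE →
        ∀ (J K : ℕ) (hJK : J ≤ K),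
          {U : GaugeField (F.P J) 0 (Matrix.specialUnitaryGroup (Fin 2) ℂ) | PlaqSmall (θBal F.L γ (c * b₀) p₀ J) U} ⊆
            Node00.regSet (fieldMeasure (F.P J) 0 (Matrix.specialUnitaryGroup (Fin 2) ℂ)) (heightDensity F γ hJK Set.univ) →
          (∀ U : GaugeField (F.P J) 0 (Matrix.specialUnitaryGroup (Fin 2) ℂ), PlaqSmall (θBal F.L γ (c * b₀) p₀ J) U →
              0 < heightDensityCan F γ hJK Set.univ U) →
          (∀ U : GaugeField (F.P J) 0 (Matrix.specialUnitaryGroup (Fin 2) ℂ), PlaqSmall (θBal F.L γ (c * b₀) p₀ J) U →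
              0 < heightDensityCan F γ hJK (histGood F ℰp (θBal F.L γ b₀ p₀) K J) U) →
          -- ═══ the engine's output at `(J, K)`: a grain and Bałaban's expansion with holes ═══
          ∃ μ' : ℕ, μ' ≤ μ ∧ μ' ≤ F.m + J ∧
          ∃ (Adm : Finset (LFLabel F K J) → Finset (PBond (F.P J) 0) → Prop)
            (ζ : Finset (LFLabel F K J) → Finset (PBond (F.P J) 0) → GaugeField (F.P J) 0 (Matrix.specialUnitaryGroup (Fin 2) ℂ) → ℝ)
            (ζbar : Finset (LFLabel F K J) → Finset (PBond (F.P J) 0) → ℝ) (κmu : ℝ),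
            -- footprint map
            (∀ Q' X, Adm Q' X → Q'.Nonempty ∧
              (∀ l ∈ Q', l.1.val < K - J ∧
              (⟨siteShift (F.sitesPerDir_eq (m := F.m) (K := K) (j := l.1.val + (K - J - l.1.val)) (m' := F.m) (K' := J) (j' := 0)
              (by have := l.1.isLt; omega)) (blkIter (K - J - l.1.val) l.2.src), l.2.μ⟩ : PBond (F.P J) 0) ∈ X) ∧
              ∃ Fc : Finset (Site (F.P J) μ'), ((touchingGraph (SiteTouch (P := F.P J) (j := μ'))).induce (Fc : Set (Site (F.P J) μ'))).Connected ∧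
              Fc.biUnion (fun y => Finset.univ.filter (fun b : PBond (F.P J) 0 => iterBlockOf μ' b.src = y)) = X) ∧
            -- the a.e. ratio identity of the expansion with holes, per deep history, on the window
            (∀ Q : Finset (LFLabel F K J), (∀ l ∈ Q, l.1.val < K - J) →
              ∀ᵐ U ∂fieldMeasure (F.P J) 0 (Matrix.specialUnitaryGroup (Fin 2) ℂ), PlaqSmall (θBal F.L γ (c * b₀) p₀ J) U →
              heightDensity F γ hJK (histEvent F (θBal F.L γ b₀ p₀) K J Q) U =
              heightDensity F γ hJK (histGood F ℰp (θBal F.L γ b₀ p₀) K J) U *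
              ∑ 𝒳 ∈ (Finset.univ : Finset (Finset (PBond (F.P J) 0))).powerset.filter (fun 𝒳 => IsCompatible polyInc 𝒳 ∧
              (∀ l ∈ Q, ∃ X ∈ 𝒳, (⟨siteShift (F.sitesPerDir_eq (m := F.m) (K := K) (j := l.1.val + (K - J - l.1.val)) (m' := F.m) (K' := J)
              (j' := 0) (by have := l.1.isLt; omega)) (blkIter (K - J - l.1.val) l.2.src), l.2.μ⟩ : PBond (F.P J) 0) ∈ X) ∧
              ∀ X ∈ 𝒳, Adm (Q.filter fun l => (⟨siteShift (F.sitesPerDir_eq (m := F.m) (K := K) (j := l.1.val + (K - J - l.1.val))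
              (m' := F.m) (K' := J) (j' := 0) (by have := l.1.isLt; omega)) (blkIter (K - J - l.1.val) l.2.src), l.2.μ⟩ : PBond (F.P J) 0) ∈ X) X),
              ∏ X ∈ 𝒳, ζ (Q.filter fun l => (⟨siteShift (F.sitesPerDir_eq (m := F.m) (K := K) (j := l.1.val + (K - J - l.1.val))
              (m' := F.m) (K' := J) (j' := 0) (by have := l.1.isLt; omega)) (blkIter (K - J - l.1.val) l.2.src), l.2.μ⟩ : PBond (F.P J) 0) ∈ X) X U) ∧
            -- continuous, V-local activities with a window-uniform majorant
            (∀ Q' X (U U' : GaugeField (F.P J) 0 (Matrix.specialUnitaryGroup (Fin 2) ℂ)), Adm Q' X → (∀ e ∈ X, U e = U' e) → ζ Q' X U = ζ Q' X U') ∧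
            (∀ Q' X U, Adm Q' X → PlaqSmall (θBal F.L γ (c * b₀) p₀ J) U → |ζ Q' X U| ≤ ζbar Q' X) ∧
            (∀ Q' X, Adm Q' X → 0 ≤ ζbar Q' X) ∧
            -- the energy bound: one small factor per hole, tree decay per block
            (∀ Q' X, Adm Q' X → ζbar Q' X ≤
              (∏ l ∈ Q', (if l.1.val < K - J then smallFactor F.L γ b₀ p₀ a (K - l.1.val) else 0)) *
              Real.exp (-(κmu * ((X.image (fun b : PBond (F.P J) 0 => iterBlockOf μ' b.src)).card : ℝ)))) ∧
            -- tree decay per block beats the entropy of block animals (a pure number)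
            4 + 2 * Real.log 26 ≤ κmu) :
    ∀ (L : ℕ), ∃ c₀ : ℝ, 0 < c₀ ∧ c₀ ≤ 1 ∧ ∀ (c : ℝ), 0 < c → c ≤ c₀ → ∃ pS : ℝ, ∀ (b₀ p₀ : ℝ), 0 < b₀ → pS ≤ p₀ → 0 < p₀ →
      ∃ γ₁ : ℝ, 0 < γ₁ ∧ ∃ κ : ℝ, 0 < κ ∧ ∀ (F : T3Family) (γ : ℝ), F.L = L → 0 < γ → γ ≤ γ₁ →
        ∃ ψ : ℕ → ℝ, (∀ J, 0 ≤ ψ J) ∧ Tendsto (fun J : ℕ => (J : ℝ) * ψ J) atTop (𝓝 0) ∧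
          ∀ (ν : ℕ → (j : ℕ) → Measure (GaugeField (F.P j) 0 (Matrix.specialUnitaryGroup (Fin 2) ℂ))),
            (∀ K, ν K K = T4GenFunBounds.gibbsMeasure (F.P K) ((F.scheme ℰp γ).β K)) →
            (∀ K j, j < K → ν K j = Measure.map (descend F ℰp j) (ν K (j + 1))) →
            ∀ (J K : ℕ) (hJK : J ≤ K) (ρ : GaugeField (F.P J) 0 (Matrix.specialUnitaryGroup (Fin 2) ℂ) → ℝ),
              (∀ U, PlaqSmall (θBal F.L γ (c * b₀) p₀ J) U → 0 < ρ U) →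
              ν K J = (fieldMeasure _ _ _).withDensity (fun U => ENNReal.ofReal (ρ U)) →
              ContinuousOn ρ {U | PlaqSmall (θBal F.L γ (c * b₀) p₀ J) U} →
              (∀ U : GaugeField (F.P J) 0 (Matrix.specialUnitaryGroup (Fin 2) ℂ), PlaqSmall (θBal F.L γ (c * b₀) p₀ J) U →
                  0 < heightDensityCan F γ hJK (histGood F ℰp (θBal F.L γ b₀ p₀) K J) U) →
              ∀ (b b' : PBond (F.P J) 0) (U V W Z : GaugeField (F.P J) 0 (Matrix.specialUnitaryGroup (Fin 2) ℂ)),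
                PlaqSmall (θBal F.L γ (c * b₀) p₀ J) U → PlaqSmall (θBal F.L γ (c * b₀) p₀ J) V →
                PlaqSmall (θBal F.L γ (c * b₀) p₀ J) W → PlaqSmall (θBal F.L γ (c * b₀) p₀ J) Z →
                (∀ e, e ≠ b → U e = V e) → (∀ e, e ≠ b' → U e = W e) → (∀ e, e ≠ b' → V e = Z e) → (∀ e, e ≠ b → W e = Z e) →
                |((fun U => Real.log (ρ U) - Real.log (heightDensityCan F γ hJK (histGood F ℰp (θBal F.L γ b₀ p₀) K J) U)) U -
                    (fun U => Real.log (ρ U) - Real.log (heightDensityCan F γ hJK (histGood F ℰp (θBal F.L γ b₀ p₀) K J) U)) V) -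
                  ((fun U => Real.log (ρ U) - Real.log (heightDensityCan F γ hJK (histGood F ℰp (θBal F.L γ b₀ p₀) K J) U)) W -
                    (fun U => Real.log (ρ U) - Real.log (heightDensityCan F γ hJK (histGood F ℰp (θBal F.L γ b₀ p₀) K J) U)) Z)|
                  ≤ ψ J * Real.exp (-(κ * (b.src.tdist b'.src : ℝ))) :=
  largeFieldFourPtIntCan_of_aeIntBare (aeIntBare_of_enginePackageBare hE)

end Summit.QuantumFields.YangMills.Theorems.FluctuationComparisonRegPrIntLLargeFieldGasBareOfEnginePackage

end
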